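import Literature.AlgebraicGeometry.AbelianVarieties.HomogeneousLineBundleFieldChange
import Literature.AlgebraicGeometry.AbelianSchemes.RigidifiedLineBundlePicZeroLocus
import Literature.AlgebraicGeometry.AbelianVarieties.RigidifiedLineBundlePicZeroLocusClosed
import HarnessLib

/-!
# «The `Pic⁰` condition spreads along a dominant map» for a family of line bundles on an abelian variety (Mumford §8, §10; Milne I §8)

Layer `Literature/AlgebraicGeometry/AbelianVarieties`, namespace `Literature.AlgebraicGeometry.AbelianSchemes.AbelianSchemeOver.RigidifiedLineBundle`.
THEOREMS ONLY (no definition, no named fact, no instance, no `sorry`).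

The junction of three leaves: for an abelian scheme `A/S`, `f : T ⟶ S` and a rigidified line bundle `ℒ` on `A_T`
(★ `AbelianSchemes/AbelianSchemeDualPair`), the head ★ `FibrewisePicZero.of_denseRange''`
(★ `AbelianSchemes/RigidifiedLineBundlePicZeroLocus`) has three inputs — ascent and descent of homogeneity of rank-one modules
along maps of algebraically closed fields (★ `AbelianVarieties/HomogeneousLineBundleFieldChange`:
`isHomogeneous_ascent_along`, `isHomogeneous_descent_along`, [MumfordAV1970] §8 (i) ⇔ (iv)) and the closedness of the `Pic⁰`
locus (★ `AbelianVarieties/RigidifiedLineBundlePicZeroLocusClosed`, seesaw [MumfordAV1970] §5 Cor. 6 / §10).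

* `fieldChangeInvariant`, `geomPointIndependent` — the two predicates of ★ `RigidifiedLineBundlePicZeroLocus` §2, PROVED for every
  rigidified line bundle;
* `FibrewisePicZero.of_denseRange_of_isClosed` — the head on the single input `IsClosed ℒ.picZeroLocus`;
* **`FibrewisePicZero.of_denseRange_of_isIntegral`**, **`FibrewisePicZero.of_denseRange_of_isAffine`** — for `A = A₀ ×_k ·`
  (`ofAbelianVariety A₀`, `A₀` an abelian variety over a field `k`) and `T` integral resp. AFFINE of finite type over `k`
  (reducible / non-reduced allowed): if `w : T₁ → T` has dense image and `ℒ` is homogeneous at every geometric point of `T`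
  factoring through `w`, then `ℒ` lies fibrewise in `Pic⁰` over all of `T` (the descent of condition (a) of [MilneAV2008] I §8
  from a dense set of points to the finite-type stage `Spec k[t]`, `k[t] ⊆ R`).

Cell `hodgecm-mathlib`, road M13 N0 (0d-2) (B-p21 (g12) / B-typ03 (g12) / B-p17 (g9) lineage).
HC_CM is proved only modulo the 7 printed citations until rung 0 closes.

## References
* [MumfordAV1970] D. Mumford, *Abelian Varieties* (1970), §5 Cor. 6, §8 ((iv) ⇔ (i)), §10 (p. 89).
* [MilneAV2008] J. S. Milne, *Abelian Varieties* (v2.00, 2008), I §8 pp. 36–37.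
-/

noncomputable section

universe u

open CategoryTheory AlgebraicGeometry Literature.AlgebraicGeometry.AbelianVarieties Literature.AlgebraicGeometry.Motives

namespace Literature.AlgebraicGeometry.AbelianSchemes.AbelianSchemeOver.RigidifiedLineBundle

variable {S T : Scheme.{u}} {A : AbelianSchemeOver S} {f : T ⟶ S} (ℒ : A.RigidifiedLineBundle f)

/-- **Field-change invariance, PROVED**: homogeneity of the fibre of `ℒ` at a geometric point is invariant under extending the
point's (algebraically closed) field (★ `fieldChangeInvariant_of_ascent_descent` fed with ★ `isHomogeneous_ascent_along` /
`isHomogeneous_descent_along`). [cite: MumfordAV1970, §8 ((iv) ⇔ (i))] -/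
theorem fieldChangeInvariant : ℒ.FieldChangeInvariant :=
  ℒ.fieldChangeInvariant_of_ascent_descent isHomogeneous_ascent_along isHomogeneous_descent_along

/-- **Independence of the geometric point, PROVED**: homogeneity of the fibre of `ℒ` does not depend on the geometric point
chosen over a scheme point. [cite: MumfordAV1970, §8 ((iv) ⇔ (i))] -/
theorem geomPointIndependent : ℒ.GeomPointIndependent :=
  ℒ.geomPointIndependent_of_fieldChangeInvariant ℒ.fieldChangeInvariant

/-- **The `Pic⁰` condition spreads along a dominant map, on the single input «the `Pic⁰` locus is closed»**: if the `Pic⁰` locus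
of `ℒ` is closed, `w : T₁ → T` has dense image and `ℒ` is homogeneous at every geometric point factoring through `w`, then `ℒ`
lies fibrewise in `Pic⁰`. [cite: MumfordAV1970, §8 ((iv) ⇔ (i)), §10 (seesaw, p. 89)] -/
theorem FibrewisePicZero.of_denseRange_of_isClosed (hcl : IsClosed ℒ.picZeroLocus)
    {T₁ : Scheme.{u}} (w : T₁ ⟶ T) (hw : DenseRange w.base)
    (h₁ : ∀ (Ω : Type u) [Field Ω] [IsAlgClosed Ω] (t₁ : Spec (.of Ω) ⟶ T₁),
      IsHomogeneous ((A.baseChange f).fibre (t₁ ≫ w)).toAbelianVariety (ℒ.fibreModule (t₁ ≫ w))) :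
    ℒ.FibrewisePicZero :=
  FibrewisePicZero.of_denseRange ℒ ℒ.geomPointIndependent hcl w hw h₁

/-- **The `Pic⁰` condition spreads along a dominant map — INTEGRAL base** locally of finite type over a field `k`, `A = A₀ ×_k ·`
for an abelian variety `A₀`: if `w : T₁ → T` has dense image (e.g. `Spec R → Spec k[t]` for `k[t] ⊆ R`,
★ `denseRange_base_specMap_of_injective`) and `ℒ` is homogeneous at every geometric point of `T` factoring through `w`, then
`ℒ` is fibrewise-`Pic⁰` over all of `T` (closedness of the locus: ★ `isClosed_picZeroLocus_of_isIntegral`).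
[cite: MumfordAV1970, §8 ((iv) ⇔ (i)), §10 (seesaw, p. 89)] [cite: MilneAV2008, I §8 pp. 36–37] -/
theorem FibrewisePicZero.of_denseRange_of_isIntegral {k : Type u} [Field k] (A₀ : AbelianVariety k)
    {T : Scheme.{u}} (f : T ⟶ Spec (.of k)) [IsIntegral T] [LocallyOfFiniteType f]
    (ℒ : (AbelianSchemeOver.ofAbelianVariety A₀).RigidifiedLineBundle f)
    {T₁ : Scheme.{u}} (w : T₁ ⟶ T) (hw : DenseRange w.base)
    (h₁ : ∀ (Ω : Type u) [Field Ω] [IsAlgClosed Ω] (t₁ : Spec (.of Ω) ⟶ T₁),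
      IsHomogeneous (((AbelianSchemeOver.ofAbelianVariety A₀).baseChange f).fibre (t₁ ≫ w)).toAbelianVariety
        (ℒ.fibreModule (t₁ ≫ w))) :
    ℒ.FibrewisePicZero :=
  FibrewisePicZero.of_denseRange_of_isClosed ℒ (isClosed_picZeroLocus_of_isIntegral A₀ f ℒ) w hw h₁

/-- **The `Pic⁰` condition spreads along a dominant map — AFFINE base of finite type** over a field `k` (reducible /
non-reduced `T` allowed; the finite-type stages `Spec k[t]`, `k[t] ⊆ R` a finitely generated subalgebra of an arbitrary affine test
ring `R`): dense image + homogeneity at the geometric points through `w` ⇒ `ℒ` fibrewise-`Pic⁰` over all of `T` (closedness of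
the locus: ★ `isClosed_picZeroLocus`). [cite: MumfordAV1970, §8 ((iv) ⇔ (i)), §10 (seesaw, p. 89)] [cite: MilneAV2008, I §8 pp. 36–37] -/
theorem FibrewisePicZero.of_denseRange_of_isAffine {k : Type u} [Field k] (A₀ : AbelianVariety k)
    {T : Scheme.{u}} (f : T ⟶ Spec (.of k)) [IsAffine T] [LocallyOfFiniteType f]
    (ℒ : (AbelianSchemeOver.ofAbelianVariety A₀).RigidifiedLineBundle f)
    {T₁ : Scheme.{u}} (w : T₁ ⟶ T) (hw : DenseRange w.base)
    (h₁ : ∀ (Ω : Type u) [Field Ω] [IsAlgClosed Ω] (t₁ : Spec (.of Ω) ⟶ T₁),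
      IsHomogeneous (((AbelianSchemeOver.ofAbelianVariety A₀).baseChange f).fibre (t₁ ≫ w)).toAbelianVariety
        (ℒ.fibreModule (t₁ ≫ w))) :
    ℒ.FibrewisePicZero :=
  FibrewisePicZero.of_denseRange_of_isClosed ℒ (isClosed_picZeroLocus A₀ f ℒ) w hw h₁

end Literature.AlgebraicGeometry.AbelianSchemes.AbelianSchemeOver.RigidifiedLineBundle

end
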